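import Mathlib.MeasureTheory.Integral.Bochner.Set
import Mathlib.MeasureTheory.Measure.Real
import Mathlib.MeasureTheory.Measure.Typeclasses.Probability
import HarnessLib

/-!
# Crux `NonSimplyConnectedLatticeGap` (stmt-QuantumFields-16405), route `ConvexGribovBody`, line `Sketch` —
# stub `stub_sectorIdentity` (card 2: the exact sector bookkeeping identity)

The law of total covariance over a finite measurable partition, in integral form. For a probability
measure `μ`, a finite measurable partition `E : K → Set Ω` of `univ` (the 't Hooft flux sectors of the
torus Wilson measure in the application) and integrable `A`, `B`, `A·B`, with `p_k = (μ E_k).toReal`,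
`a_k = ∫_{E_k} A`, `b_k = ∫_{E_k} B`:

`∫AB − ∫A ∫B = Σ_k (∫_{E_k} AB − p_k⁻¹ a_k b_k) + ½ Σ_{k,k'} p_k⁻¹ p_{k'}⁻¹ (p_{k'} a_k − p_k a_{k'}) (p_{k'} b_k − p_k b_{k'})`.

The identity is junk-safe at null sectors: if `p_k = 0` then `μ E_k = 0` (the measure is finite), so
`a_k = b_k = 0`, and every term containing `p_k⁻¹ = 0` or `a_k`, `b_k` vanishes on both sides of the
termwise expansion. The proof is: (i) `Σ_k ∫_{E_k} F = ∫ F` (`integral_iUnion_fintype` + the cover) and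
`Σ_k p_k = 1`; (ii) a purely algebraic finite-sum identity (`sectorIdentity_algebra`).
-/

set_option autoImplicit false

noncomputable section

open MeasureTheory

namespace Summit.QuantumFields.YangMills.Theorems.NonSimplyConnectedLatticeGap

/-- **The algebraic core.** For reals `p a b c : K → ℝ` over a finite index type with `Σ p = 1`,
`Σ a = IA`, `Σ b = IB`, `Σ c = IAB` and the junk-safety condition `p k = 0 → a k = 0 ∧ b k = 0`:
`IAB − IA·IB = Σ_k (c_k − p_k⁻¹ a_k b_k) + ½ Σ_{k,k'} p_k⁻¹ p_{k'}⁻¹ (p_{k'} a_k − p_k a_{k'}) (p_{k'} b_k − p_k b_{k'})`. -/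
theorem sectorIdentity_algebra {K : Type} [Fintype K] (p a b c : K → ℝ) (IA IB IAB : ℝ)
    (hp : ∑ k, p k = 1) (ha : ∑ k, a k = IA) (hb : ∑ k, b k = IB) (hc : ∑ k, c k = IAB)
    (h0 : ∀ k, p k = 0 → a k = 0 ∧ b k = 0) :
    IAB - IA * IB
      = (∑ k, (c k - (p k)⁻¹ * a k * b k))
        + (1 / 2) * ∑ k, ∑ k', (p k)⁻¹ * (p k')⁻¹ * ((p k' * a k) - p k * a k')
            * ((p k' * b k) - p k * b k') := by
  -- termwise expansion, junk-safe at `p k = 0` / `p k' = 0`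
  have hterm : ∀ k k', (p k)⁻¹ * (p k')⁻¹ * ((p k' * a k) - p k * a k') * ((p k' * b k) - p k * b k')
      = (p k)⁻¹ * a k * b k * p k' - a k * b k' - a k' * b k + (p k')⁻¹ * a k' * b k' * p k := by
    intro k k'
    by_cases hk : p k = 0
    · obtain ⟨hak, hbk⟩ := h0 k hk
      simp [hk, hak, hbk]
    by_cases hk' : p k' = 0
    · obtain ⟨hak', hbk'⟩ := h0 k' hk'
      simp [hk', hak', hbk']
    field_simp
    ring
  have hX : ∑ k, ∑ k', (p k)⁻¹ * a k * b k * p k' = ∑ k, (p k)⁻¹ * a k * b k := by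
    refine Finset.sum_congr rfl fun k _ => ?_
    rw [← Finset.mul_sum, hp, mul_one]
  have hY : ∑ k, ∑ k', a k * b k' = IA * IB := by
    rw [← ha, ← hb, Fintype.sum_mul_sum]
  have hZ : ∑ k, ∑ k', a k' * b k = IA * IB := by
    rw [Finset.sum_comm, ← ha, ← hb, Fintype.sum_mul_sum]
  have hW : ∑ k, ∑ k', (p k')⁻¹ * a k' * b k' * p k = ∑ k, (p k)⁻¹ * a k * b k := by
    rw [Finset.sum_comm]
    refine Finset.sum_congr rfl fun k _ => ?_
    rw [← Finset.mul_sum, hp, mul_one]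
  have h2 : ∑ k, ∑ k', (p k)⁻¹ * (p k')⁻¹ * ((p k' * a k) - p k * a k') * ((p k' * b k) - p k * b k')
      = 2 * ∑ k, (p k)⁻¹ * a k * b k - 2 * (IA * IB) := by
    simp only [hterm, Finset.sum_add_distrib, Finset.sum_sub_distrib, hX, hY, hZ, hW]
    ring
  rw [h2, Finset.sum_sub_distrib, hc]
  ring

/-- **Card 2's sector bookkeeping identity** (law of total covariance over a finite measurable partition,
integral form). For a probability measure `μ` on `Ω`, a finite measurable partition `E : K → Set Ω` of
`univ`, and integrable `A`, `B`, `A·B`, with `p_k = (μ E_k).toReal`: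
`∫AB − ∫A∫B = Σ_k (∫_{E_k}AB − p_k⁻¹ ∫_{E_k}A ∫_{E_k}B)
  + ½ Σ_{k,k'} p_k⁻¹ p_{k'}⁻¹ (p_{k'}∫_{E_k}A − p_k∫_{E_{k'}}A)(p_{k'}∫_{E_k}B − p_k∫_{E_{k'}}B)`
(junk-safe at `p_k = 0`, where `∫_{E_k} = 0`). -/
theorem stub_sectorIdentity : ∀ (Ω : Type) [MeasurableSpace Ω] (μ : MeasureTheory.Measure Ω) [MeasureTheory.IsProbabilityMeasure μ] (K : Type) [Fintype K] (E : K → Set Ω), (∀ k, MeasurableSet (E k)) → Pairwise (Function.onFun Disjoint E) → (⋃ k, E k) = Set.univ → ∀ A B : Ω → ℝ, MeasureTheory.Integrable A μ → MeasureTheory.Integrable B μ → MeasureTheory.Integrable (fun ω => A ω * B ω) μ → (∫ ω, A ω * B ω ∂μ) - (∫ ω, A ω ∂μ) * (∫ ω, B ω ∂μ) = (∑ k, ((∫ ω in E k, A ω * B ω ∂μ) - ((μ (E k)).toReal)⁻¹ * (∫ ω in E k, A ω ∂μ) * (∫ ω in E k, B ω ∂μ))) + (1 / 2) * ∑ k,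 ∑ k', ((μ (E k)).toReal)⁻¹ * ((μ (E k')).toReal)⁻¹ * (((μ (E k')).toReal * ∫ ω in E k, A ω ∂μ) - (μ (E k)).toReal * ∫ ω in E k', A ω ∂μ) * (((μ (E k')).toReal * ∫ ω in E k, B ω ∂μ) - (μ (E k)).toReal * ∫ ω in E k', B ω ∂μ) := by
  intro Ω _ μ _ K _ E hE hdisj hcover A B hA hB hAB
  -- (i) sums over the finite measurable partition
  have hsum : ∀ F : Ω → ℝ, Integrable F μ → ∑ k, ∫ ω in E k, F ω ∂μ = ∫ ω, F ω ∂μ := by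
    intro F hF
    rw [← integral_iUnion_fintype hE hdisj (fun k => hF.integrableOn), hcover, setIntegral_univ]
  have hp : ∑ k, (μ (E k)).toReal = 1 := by
    have h := measureReal_iUnion_fintype (μ := μ) hdisj hE
    rw [hcover, probReal_univ] at h
    simpa only [measureReal_def] using h.symm
  -- null sectors carry no integral
  have h0 : ∀ k, (μ (E k)).toReal = 0 → (∫ ω in E k, A ω ∂μ) = 0 ∧ (∫ ω in E k, B ω ∂μ) = 0 := by
    intro k hk
    have hk0 : μ (E k) = 0 := by
      rcases (ENNReal.toReal_eq_zero_iff _).mp hk with h | h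
      · exact h
      · exact absurd h (measure_ne_top μ _)
    exact ⟨setIntegral_measure_zero _ hk0, setIntegral_measure_zero _ hk0⟩
  -- (ii) pure algebra
  exact sectorIdentity_algebra (fun k => (μ (E k)).toReal) (fun k => ∫ ω in E k, A ω ∂μ)
    (fun k => ∫ ω in E k, B ω ∂μ) (fun k => ∫ ω in E k, A ω * B ω ∂μ) _ _ _ hp (hsum A hA) (hsum B hB)
    (hsum _ hAB) h0

end Summit.QuantumFields.YangMills.Theorems.NonSimplyConnectedLatticeGap

end
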